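import Summits.AtomisticToContinuum.FouriersLaw.Theses.KineticCorner
import Summits.AtomisticToContinuum.FouriersLaw.Theorems.KineticCornerStationaryCorrelationBound
import Summits.AtomisticToContinuum.FouriersLaw.Theorems.EmbeddedDrudeMourreDrudeDissolutionFejerAtomBound
import Summits.AtomisticToContinuum.FouriersLaw.Theorems.DrudeDissolution.Negative.SpectralPairNecessities
import HarnessLib

/-!
# Crux `DrudeDissolution` (stmt-AtomisticToContinuum-12593): THE KINETIC WINDOW ALONE DISSOLVES THE
# HARMONIC DRUDE ATOM TO LEADING ORDER — `σ_T{0} ≤ η T²` from `KineticCorner.KineticLimit`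

`--supports stmt-AtomisticToContinuum-12593` (line `gram-pencil-harmonic-chaos`, lead c12). A typed structural fact for the
planners of the sub-problem `FouriersLaw`, CONDITIONAL on route KineticCorner's crux `KineticLimit` (stmt-3431, finite kinetic
windows; research-open) and otherwise using only LANDED inputs (`KineticCorner.stationaryCorrelationBound_proof`: `|C_T| ≤ B T²`,
and the Fejér bound `DrudeDissolution.atom_le_of_running_le`):

* `atom_eq_zero_of_postKineticTail` — assuming `PostKineticTail` (stmt-3430) instead: at every small `T` the running Green–Kubo
  integrals of a GOOD triple are bounded, hence `σ{0} = 0` EXACTLY (`atom_eq_zero_of_running_le`);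
* `drudeWeight_le_of_kineticLimit` — assuming `KineticLimit`, for all parameters and every `η > 0` there is `T₀ > 0` such that
  for every GOOD triple `(T, μ, D)` (the KineticCorner conjunction, verbatim) with `T < T₀` and every finite measure `σ` representing
  the summed current autocorrelation, `C_T(t) = ∫ cos(ωt) dσ(ω)`, the DRUDE WEIGHT obeys `σ{0} ≤ η · T²`.

Since `C_T(0) = σ(ℝ) ≍ T²` (`stationaryCorrelationBound_proof`, and `≥ c T²` for the canonical data), this says: the Drude atom of
the harmonic chain (`σ₀ = χ₀ δ₀`, all the spectral mass at frequency `0`) carries an `o(1)` FRACTION of the spectral mass as `T → 0`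
as soon as the kinetic picture holds on FINITE kinetic windows — no `t = ∞` input (no `PostKineticTail`, stmt-3430) is needed for
that. What the crux `DrudeDissolution` asks beyond it at each fixed small `T` — `σ_T{0} = 0` EXACTLY and a continuous density through
`0` — is therefore located entirely in the post-kinetic regime (STRATEGY-CENSUS.md §Decomposition: "which piece remains the whole
crux: Sub₂").

Proof: Fejér. By `atom_le_of_running_le`, `σ{0} ≤ 2A/R` whenever the running Green–Kubo integrals `∫₀^t C_T` are `≤ A` on
`[0, R]`. Take `R = N T⁻²` with `N` kinetic units: on `[0, T⁻²]` the a-priori bound gives `|∫₀^t C_T| ≤ B`; `KineticLimit` with the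
windows `(1, i)`, `i = 1, …, N` (finitely many, one `T₀` by induction) gives `∫_{T⁻²}^{iT⁻²} C_T ≤ ∫_1^i K + 1 ≤ ‖K‖₁ + 1`; the
remainder of a unit cell costs another `B`. So `A = 2B + ‖K‖₁ + 1` works for every `N`, and `σ{0} ≤ 2A T²/N ≤ η T²` for
`N ≥ 2A/η`.

Sorry-free; axioms `propext`, `Classical.choice`, `Quot.sound`. CONDITIONAL on `KineticLimit` (hypothesis, an open crux of route
KineticCorner) — an implication, not a `conditional-result` on a named fact.
-/

noncomputable section

namespace Summit.AtomisticToContinuum.FouriersLaw.Theorems.DrudeDissolution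

open MeasureTheory Filter Set Topology
open Literature.MathematicalPhysics.KineticTheory.HeatConduction

/-- Uniform `T₀` for finitely many kinetic windows `(1, i)`, `i = 1, …, n`, out of the window clause of `KineticLimit`
(induction on `n`, taking minima). -/
theorem kineticWindows_uniform {ω₂ lam β γ : ℝ} {K : ℝ → ℝ}
    (hwin : ∀ δ M e : ℝ, 0 < δ → δ ≤ M → 0 < e → ∃ T₀ : ℝ, 0 < T₀ ∧
      ∀ (T : ℝ) (μ : Measure ChainConfig) (D : InfiniteChainDynamics (pinnedChain ω₂ lam β γ)), 0 < T → T < T₀ →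
        ((pinnedChain ω₂ lam β γ).IsChainGibbsMeasure T μ ∧ D.PreservesMeasure μ ∧ (∀ t : ℝ, D.HasAbsConvergentCorrelation μ t) ∧ (∀ S : ℝ, MeasureTheory.IntegrableOn (D.currentCorrelation μ) (Set.Icc 0 S)) ∧ MeasureTheory.MeasurePreserving (fun σ : ChainConfig => fun i : ℤ => σ (i + 1)) μ μ ∧ (∀ (t : ℝ) (σ : ChainConfig), D.flow t (fun i : ℤ => σ (i + 1)) = fun i : ℤ => D.flow t σ (i + 1))) →
          |(∫ t in (δ / T ^ 2)..(M / T ^ 2), D.currentCorrelation μ t) - ∫ τ in δ..M, K τ| ≤ e)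
    (n : ℕ) :
    ∃ T₀ : ℝ, 0 < T₀ ∧ ∀ i : ℕ, 1 ≤ i → i ≤ n →
      ∀ (T : ℝ) (μ : Measure ChainConfig) (D : InfiniteChainDynamics (pinnedChain ω₂ lam β γ)), 0 < T → T < T₀ →
        ((pinnedChain ω₂ lam β γ).IsChainGibbsMeasure T μ ∧ D.PreservesMeasure μ ∧ (∀ t : ℝ, D.HasAbsConvergentCorrelation μ t) ∧ (∀ S : ℝ, MeasureTheory.IntegrableOn (D.currentCorrelation μ) (Set.Icc 0 S)) ∧ MeasureTheory.MeasurePreserving (fun σ : ChainConfig => fun i : ℤ => σ (i + 1)) μ μ ∧ (∀ (t : ℝ) (σ : ChainConfig), D.flow t (fun i : ℤ => σ (i + 1)) = fun i : ℤ => D.flow t σ (i + 1))) →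
          |(∫ t in (1 / T ^ 2)..((i : ℝ) / T ^ 2), D.currentCorrelation μ t) - ∫ τ in (1 : ℝ)..(i : ℝ), K τ| ≤ 1 := by
  induction n with
  | zero => exact ⟨1, one_pos, fun i hi hi0 => absurd (hi.trans hi0) (by norm_num)⟩
  | succ n ih =>
    obtain ⟨T₀, hT₀, h⟩ := ih
    have hle : (1 : ℝ) ≤ ((n + 1 : ℕ) : ℝ) := by exact_mod_cast Nat.succ_le_succ (Nat.zero_le n)
    obtain ⟨T₀', hT₀', h'⟩ := hwin 1 ((n + 1 : ℕ) : ℝ) 1 one_pos hle one_pos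
    refine ⟨min T₀ T₀', lt_min hT₀ hT₀', fun i hi hin T μ D hT hTlt hgood => ?_⟩
    rcases Nat.lt_or_ge i (n + 1) with hlt | hge
    · exact h i hi (Nat.lt_succ_iff.mp hlt) T μ D hT (hTlt.trans_le (min_le_left _ _)) hgood
    · have hieq : i = n + 1 := le_antisymm hin hge
      subst hieq
      exact h' T μ D hT (hTlt.trans_le (min_le_right _ _)) hgood

/-- **THE KINETIC WINDOW ALONE DISSOLVES THE DRUDE ATOM TO LEADING ORDER** (registered sub-goal `drudeWeight_le_of_kineticLimit`
of stmt-AtomisticToContinuum-12593; CONDITIONAL on `KineticCorner.KineticLimit`, stmt-3431): for every `η > 0`, all GOOD triples at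
small enough `T` with a cosine-represented current autocorrelation have Drude weight `σ{0} ≤ η T²`. [folklore] -/
theorem drudeWeight_le_of_kineticLimit : Summit.AtomisticToContinuum.FouriersLaw.Theses.KineticCorner.KineticLimit → ∀ ω₂ lam β γ : ℝ, 0 < ω₂ → 0 < lam → 0 < β → 0 < γ → ∀ η : ℝ, 0 < η → ∃ T₀ : ℝ, 0 < T₀ ∧ ∀ (T : ℝ) (μ : MeasureTheory.Measure Literature.MathematicalPhysics.KineticTheory.HeatConduction.ChainConfig) (D : Literature.MathematicalPhysics.KineticTheory.HeatConduction.InfiniteChainDynamics (Literature.MathematicalPhysics.KineticTheory.HeatConduction.pinnedChain ω₂ lam β γ)), 0 < T → T < T₀ → ((Literature.MathematicalPhysics.KineticTheory.HeatConduction.pinnedChain ω₂ lam β γ).IsChainGibbsMeasure T μ ∧ D.PreservesMeasure μ ∧ (∀ t : ℝ, D.HasAbsConvergentCorrelation μ t) ∧ (∀ S : ℝ, MeasureTheory.IntegrableOn (D.currentCorrelation μ) (Set.Icc 0 S)) ∧ MeasureTheory.MeasurePreserving (fun σ : Literature.MathematicalPhysics.KineticTheory.HeatConduction.ChainConfig =>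 fun i : ℤ => σ (i + 1)) μ μ ∧ (∀ (t : ℝ) (σ : Literature.MathematicalPhysics.KineticTheory.HeatConduction.ChainConfig), D.flow t (fun i : ℤ => σ (i + 1)) = fun i : ℤ => D.flow t σ (i + 1))) → ∀ (σ : MeasureTheory.Measure ℝ) [MeasureTheory.IsFiniteMeasure σ], (∀ t : ℝ, D.currentCorrelation μ t = ∫ ω, Real.cos (ω * t) ∂σ) → σ.real {0} ≤ η * T ^ 2 := by
  intro hKL ω₂ lam β γ hω hl hβ hγ η hη
  obtain ⟨K, hKint, -, hwin⟩ := hKL ω₂ lam β γ hω hl hβ hγ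
  obtain ⟨B, T₁, hT₁, hB⟩ :=
    Summit.AtomisticToContinuum.FouriersLaw.Theorems.KineticCorner.stationaryCorrelationBound_proof ω₂ lam β γ hω hl hβ hγ
  -- constants
  set B' : ℝ := max B 0 with hB'def
  have hB'0 : 0 ≤ B' := le_max_right _ _
  set K₁ : ℝ := ∫ τ in Ioi (0 : ℝ), |K τ| with hK₁def
  have hK₁0 : 0 ≤ K₁ := setIntegral_nonneg measurableSet_Ioi fun τ _ => abs_nonneg _
  set A : ℝ := 2 * B' + K₁ + 1 with hAdef
  have hA0 : 0 < A := by positivity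
  -- number of kinetic cells
  set N : ℕ := ⌈2 * A / η⌉₊ + 1 with hNdef
  have hN1 : 1 ≤ N := Nat.le_add_left 1 _
  have hNpos : (0 : ℝ) < N := by exact_mod_cast hN1
  have hNge : 2 * A / η ≤ (N : ℝ) := by
    have h1 : 2 * A / η ≤ (⌈2 * A / η⌉₊ : ℝ) := Nat.le_ceil _
    have h2 : ((⌈2 * A / η⌉₊ : ℕ) : ℝ) ≤ (N : ℝ) := by exact_mod_cast Nat.le_succ _
    exact h1.trans h2
  -- uniform T₀ for the windows (1, i), i ≤ N
  obtain ⟨T₀', hT₀', hW⟩ := kineticWindows_uniform hwin N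
  refine ⟨min T₀' T₁, lt_min hT₀' hT₁, ?_⟩
  intro T μ D hT hTlt hgood σ _ hC
  have hT' : T < T₀' := hTlt.trans_le (min_le_left _ _)
  have hT₁' : T < T₁ := hTlt.trans_le (min_le_right _ _)
  have hT2 : 0 < T ^ 2 := by positivity
  -- the current autocorrelation: continuous, a priori bound on `[0, ∞)`
  set C : ℝ → ℝ := D.currentCorrelation μ with hCdef
  have hcont : Continuous C := Negative.continuous_cosine hC
  have hbound : ∀ t : ℝ, 0 ≤ t → |C t| ≤ B' * T ^ 2 := fun t ht =>
    (hB T μ D hT hT₁' hgood t ht).trans (mul_le_mul_of_nonneg_right (le_max_left _ _) hT2.le)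
  -- integral over a sub-interval of `[0, ∞)` of length `ℓ` is at most `B' T² ℓ`
  have hpiece : ∀ a b : ℝ, 0 ≤ a → a ≤ b → |∫ t in a..b, C t| ≤ B' * T ^ 2 * (b - a) := by
    intro a b ha hab
    have h := intervalIntegral.norm_integral_le_of_norm_le_const (a := a) (b := b) (f := C)
      (C := B' * T ^ 2) (fun t ht => by
        rw [uIoc_of_le hab] at ht
        rw [Real.norm_eq_abs]
        exact hbound t (ha.trans ht.1.le))
    rw [Real.norm_eq_abs, abs_of_nonneg (sub_nonneg.2 hab)] at h
    exact h
  -- the window bounds: `∫_{1/T²}^{i/T²} C ≤ K₁ + 1` for `1 ≤ i ≤ N`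
  have hKwin : ∀ i : ℕ, 1 ≤ i → i ≤ N → ∫ t in (1 / T ^ 2)..((i : ℝ) / T ^ 2), C t ≤ K₁ + 1 := by
    intro i hi hiN
    have h := hW i hi hiN T μ D hT hT' hgood
    have hsub : Ioc (1 : ℝ) i ⊆ Ioi (0 : ℝ) := Ioc_subset_Ioi_self.trans (Ioi_subset_Ioi zero_le_one)
    have hKabs : IntegrableOn (fun τ : ℝ => |K τ|) (Ioi (0 : ℝ)) := hKint.abs
    have hKi : ∫ τ in (1 : ℝ)..(i : ℝ), K τ ≤ K₁ := by
      have h1i : (1 : ℝ) ≤ i := by exact_mod_cast hi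
      rw [intervalIntegral.integral_of_le h1i]
      calc ∫ τ in Ioc (1 : ℝ) i, K τ ≤ ∫ τ in Ioc (1 : ℝ) i, |K τ| :=
            setIntegral_mono_on (hKint.mono_set hsub) (hKabs.mono_set hsub) measurableSet_Ioc
              fun τ _ => le_abs_self _
        _ ≤ ∫ τ in Ioi (0 : ℝ), |K τ| :=
            setIntegral_mono_set hKabs (Eventually.of_forall fun τ => abs_nonneg _)
              (Eventually.of_forall hsub)
    have := (abs_le.mp h).2
    linarith
  -- the running Green–Kubo integrals are `≤ A` on `[0, N/T²]`
  have hrun : ∀ t ∈ Icc (0 : ℝ) ((N : ℝ) / T ^ 2), ∫ s in (0 : ℝ)..t, C s ≤ A := by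
    intro t ht
    have ht0 : 0 ≤ t := ht.1
    -- position in kinetic units
    set u : ℝ := t * T ^ 2 with hudef
    have hu0 : 0 ≤ u := by positivity
    have huN : u ≤ N := by
      have := ht.2
      rw [le_div_iff₀ hT2] at this
      exact this
    have htu : t = u / T ^ 2 := by rw [hudef]; field_simp
    by_cases hu1 : u < 1
    · -- inside the first kinetic cell: `|∫₀^t C| ≤ B' T² t ≤ B'`
      have h1 := hpiece 0 t le_rfl ht0
      have ht1 : t ≤ 1 / T ^ 2 := by
        rw [htu]; exact div_le_div_of_nonneg_right hu1.le hT2.le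
      have : B' * T ^ 2 * (t - 0) ≤ B' := by
        rw [sub_zero]
        calc B' * T ^ 2 * t ≤ B' * T ^ 2 * (1 / T ^ 2) := by gcongr
          _ = B' := by field_simp
      have h2 := (abs_le.mp (h1.trans this)).2
      have hA' : B' ≤ A := by rw [hAdef]; linarith
      exact h2.trans hA'
    · push Not at hu1
      -- `i = ⌊u⌋₊ ≥ 1`, `i ≤ u < i + 1`, `i ≤ N`
      set i : ℕ := ⌊u⌋₊ with hidef
      have hi1 : 1 ≤ i := Nat.le_floor (by exact_mod_cast hu1)
      have hiu : (i : ℝ) ≤ u := Nat.floor_le hu0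
      have hui : u < i + 1 := Nat.lt_floor_add_one u
      have hiN : i ≤ N := by
        have : (i : ℝ) ≤ N := hiu.trans huN
        exact_mod_cast this
      have hsplit₁ : ∫ s in (0 : ℝ)..t, C s =
          (∫ s in (0 : ℝ)..(1 / T ^ 2), C s) + ∫ s in (1 / T ^ 2)..t, C s :=
        (intervalIntegral.integral_add_adjacent_intervals (hcont.intervalIntegrable _ _)
          (hcont.intervalIntegrable _ _)).symm
      have hsplit₂ : ∫ s in (1 / T ^ 2)..t, C s =
          (∫ s in (1 / T ^ 2)..((i : ℝ) / T ^ 2), C s) + ∫ s in ((i : ℝ) / T ^ 2)..t, C s :=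
        (intervalIntegral.integral_add_adjacent_intervals (hcont.intervalIntegrable _ _)
          (hcont.intervalIntegrable _ _)).symm
      -- the three pieces
      have hp1 : ∫ s in (0 : ℝ)..(1 / T ^ 2), C s ≤ B' := by
        have h := hpiece 0 (1 / T ^ 2) le_rfl (by positivity)
        have : B' * T ^ 2 * (1 / T ^ 2 - 0) = B' := by rw [sub_zero]; field_simp
        rw [this] at h
        exact (abs_le.mp h).2
      have hp2 : ∫ s in (1 / T ^ 2)..((i : ℝ) / T ^ 2), C s ≤ K₁ + 1 := hKwin i hi1 hiN
      have hp3 : ∫ s in ((i : ℝ) / T ^ 2)..t, C s ≤ B' := by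
        have hit : (i : ℝ) / T ^ 2 ≤ t := by
          rw [htu]; exact div_le_div_of_nonneg_right hiu hT2.le
        have h := hpiece ((i : ℝ) / T ^ 2) t (by positivity) hit
        have hlen : B' * T ^ 2 * (t - (i : ℝ) / T ^ 2) ≤ B' := by
          have : t - (i : ℝ) / T ^ 2 = (u - i) / T ^ 2 := by rw [htu]; field_simp
          rw [this]
          calc B' * T ^ 2 * ((u - i) / T ^ 2) = B' * (u - i) := by field_simp
            _ ≤ B' * 1 := by gcongr; linarith
            _ = B' := mul_one _
        exact (abs_le.mp (h.trans hlen)).2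
      rw [hsplit₁, hsplit₂, hAdef]
      linarith
  -- Fejér: `σ{0} ≤ 2A / (N/T²) = 2 A T² / N ≤ η T²`
  have hR : (0 : ℝ) < (N : ℝ) / T ^ 2 := by positivity
  have hatom := atom_le_of_running_le hC hR hrun
  calc σ.real {0} ≤ 2 * A / ((N : ℝ) / T ^ 2) := hatom
    _ = (2 * A / N) * T ^ 2 := by field_simp
    _ ≤ η * T ^ 2 := by
        gcongr
        rw [div_le_iff₀ hNpos]
        calc 2 * A = (2 * A / η) * η := by field_simp
          _ ≤ N * η := by gcongr
          _ = η * N := mul_comm _ _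

/-- **THE POST-KINETIC TAIL ALONE EXCLUDES THE DRUDE ATOM EXACTLY** (registered sub-goal `atom_eq_zero_of_postKineticTail` of
stmt-AtomisticToContinuum-12593; CONDITIONAL on `KineticCorner.PostKineticTail`, stmt-3430): at every small enough `T`, every GOOD
triple with a cosine-represented current autocorrelation has `σ{0} = 0` — the running Green–Kubo integrals are bounded
(`|∫₀^t C_T| ≤ B·M + 1`: a priori bound up to the kinetic horizon `M T⁻²`, tail mass `≤ 1` beyond it), so
`atom_eq_zero_of_running_le` applies. Contrast with `drudeWeight_le_of_kineticLimit` (finite windows: atom `o(T²)` only); the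
crux `DrudeDissolution` asks, beyond both, for a CONTINUOUS POSITIVE density through `0`. [folklore] -/
theorem atom_eq_zero_of_postKineticTail : Summit.AtomisticToContinuum.FouriersLaw.Theses.KineticCorner.PostKineticTail → ∀ ω₂ lam β γ : ℝ, 0 < ω₂ → 0 < lam → 0 < β → 0 < γ → ∃ T₀ : ℝ, 0 < T₀ ∧ ∀ (T : ℝ) (μ : MeasureTheory.Measure Literature.MathematicalPhysics.KineticTheory.HeatConduction.ChainConfig) (D : Literature.MathematicalPhysics.KineticTheory.HeatConduction.InfiniteChainDynamics (Literature.MathematicalPhysics.KineticTheory.HeatConduction.pinnedChain ω₂ lam β γ)), 0 < T → T < T₀ → ((Literature.MathematicalPhysics.KineticTheory.HeatConduction.pinnedChain ω₂ lam β γ).IsChainGibbsMeasure T μ ∧ D.PreservesMeasure μ ∧ (∀ t : ℝ, D.HasAbsConvergentCorrelation μ t) ∧ (∀ S : ℝ, MeasureTheory.IntegrableOn (D.currentCorrelation μ) (Set.Icc 0 S)) ∧ MeasureTheory.MeasurePreserving (fun σ : Literature.MathematicalPhysics.KineticTheory.HeatConduction.ChainConfig => fun i : ℤ => σ (i + 1))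 μ μ ∧ (∀ (t : ℝ) (σ : Literature.MathematicalPhysics.KineticTheory.HeatConduction.ChainConfig), D.flow t (fun i : ℤ => σ (i + 1)) = fun i : ℤ => D.flow t σ (i + 1))) → ∀ (σ : MeasureTheory.Measure ℝ) [MeasureTheory.IsFiniteMeasure σ], (∀ t : ℝ, D.currentCorrelation μ t = ∫ ω, Real.cos (ω * t) ∂σ) → σ {0} = 0 := by
  intro hPKT ω₂ lam β γ hω hl hβ hγ
  obtain ⟨M, T₀', hM, hT₀', htail⟩ := hPKT ω₂ lam β γ hω hl hβ hγ 1 one_pos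
  obtain ⟨B, T₁, hT₁, hB⟩ :=
    Summit.AtomisticToContinuum.FouriersLaw.Theorems.KineticCorner.stationaryCorrelationBound_proof ω₂ lam β γ hω hl hβ hγ
  refine ⟨min T₀' T₁, lt_min hT₀' hT₁, ?_⟩
  intro T μ D hT hTlt hgood σ _ hC
  have hT' : T < T₀' := hTlt.trans_le (min_le_left _ _)
  have hT₁' : T < T₁ := hTlt.trans_le (min_le_right _ _)
  have hT2 : 0 < T ^ 2 := by positivity
  set B' : ℝ := max B 0 with hB'def
  have hB'0 : 0 ≤ B' := le_max_right _ _
  set C : ℝ → ℝ := D.currentCorrelation μ with hCdef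
  have hcont : Continuous C := Negative.continuous_cosine hC
  have hbound : ∀ t : ℝ, 0 ≤ t → |C t| ≤ B' * T ^ 2 := fun t ht =>
    (hB T μ D hT hT₁' hgood t ht).trans (mul_le_mul_of_nonneg_right (le_max_left _ _) hT2.le)
  obtain ⟨hint, hmass⟩ := htail T μ D hT hT' hgood
  have hpiece : ∀ a b : ℝ, 0 ≤ a → a ≤ b → |∫ t in a..b, C t| ≤ B' * T ^ 2 * (b - a) := by
    intro a b ha hab
    have h := intervalIntegral.norm_integral_le_of_norm_le_const (a := a) (b := b) (f := C)
      (C := B' * T ^ 2) (fun t ht => by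
        rw [uIoc_of_le hab] at ht
        rw [Real.norm_eq_abs]
        exact hbound t (ha.trans ht.1.le))
    rw [Real.norm_eq_abs, abs_of_nonneg (sub_nonneg.2 hab)] at h
    exact h
  set R : ℝ := M / T ^ 2 with hRdef
  have hR0 : 0 ≤ R := by positivity
  have hhead : ∀ t : ℝ, 0 ≤ t → t ≤ R → ∫ s in (0 : ℝ)..t, C s ≤ B' * M := by
    intro t ht htR
    have h := hpiece 0 t le_rfl ht
    rw [sub_zero] at h
    calc ∫ s in (0 : ℝ)..t, C s ≤ B' * T ^ 2 * t := (abs_le.mp h).2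
      _ ≤ B' * T ^ 2 * R := by gcongr
      _ = B' * M := by rw [hRdef]; field_simp
  refine atom_eq_zero_of_running_le hC (A := B' * M + 1) fun t ht => ?_
  by_cases htR : t ≤ R
  · have := hhead t ht htR
    linarith
  · push Not at htR
    have hsplit : ∫ s in (0 : ℝ)..t, C s = (∫ s in (0 : ℝ)..R, C s) + ∫ s in R..t, C s :=
      (intervalIntegral.integral_add_adjacent_intervals (hcont.intervalIntegrable _ _)
        (hcont.intervalIntegrable _ _)).symm
    have hCabs : IntegrableOn (fun s : ℝ => |C s|) (Ioi R) := hint.abs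
    have htailt : ∫ s in R..t, C s ≤ 1 := by
      rw [intervalIntegral.integral_of_le htR.le]
      calc ∫ s in Ioc R t, C s ≤ ∫ s in Ioc R t, |C s| :=
            setIntegral_mono_on (hint.mono_set Ioc_subset_Ioi_self) (hCabs.mono_set Ioc_subset_Ioi_self)
              measurableSet_Ioc fun s _ => le_abs_self _
        _ ≤ ∫ s in Ioi R, |C s| :=
            setIntegral_mono_set hCabs (Eventually.of_forall fun s => abs_nonneg _)
              (Eventually.of_forall Ioc_subset_Ioi_self)
        _ ≤ 1 := hmass
    rw [hsplit]
    have := hhead R hR0 le_rfl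
    linarith

end Summit.AtomisticToContinuum.FouriersLaw.Theorems.DrudeDissolution

end
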